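import Mathlib
import HarnessLib
import Literature.NumberTheory.LFunctions.ZetaScrew
import Summits.RiemannHypothesis.RiemannHypothesis.Theorems.IntegerScrewRung128
import Summits.RiemannHypothesis.RiemannHypothesis.Theorems.MotivicDoorSemilocalClosed
import Summits.RiemannHypothesis.RiemannHypothesis.Theorems.WeilFormatCDataA1RungCB
import Summits.RiemannHypothesis.RiemannHypothesis.Theorems.IntegerScrewTopBlockNegHead
import Summits.RiemannHypothesis.RiemannHypothesis.Theorems.DbrLatticeAntipersistence
import Summits.RiemannHypothesis.RiemannHypothesis.Theorems.DbrWallLogTableA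
import Summits.RiemannHypothesis.RiemannHypothesis.Theorems.InventoryDeletionBlindnessBump

/-!
# W-06 cycle 5, cell C4⁵ (T) «DELETION-UNIFORM TRANSFERS» — Floor uniformity and detection laws

Uniformity in the REST of `D`: at level `p₁ + 1` only the floor matters.

For a deleted set `D` with floor `p₁ = min D`, the kept Gram matrix at level `p₁ + 1` equals the
single-deletion one: `S_{p₁+1}(ζ_{ℙ∖D}) = S_{p₁+1}(ζ_{ℙ∖{p₁}})`. Hence the DETECTION LAW
`M₀(ℙ∖D) = p₁ + 1` for `p₁ ∈ {2,3,5,7}` holds for EVERY such `D`, in kernel form.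

TEST 0: both sides are finite rungs; 0 bits toward `Re ρ(ζ)`. Nothing here bears on the truth of RH.
-/

set_option linter.dupNamespace false

namespace RhIdea6.G14.Transfer

open Literature.NumberTheory.LFunctions Finset
open Summit.RiemannHypothesis.RiemannHypothesis.Theorems.IntegerScrew
open scoped BigOperators

/-! ## §9. Uniformity in the REST of `D`: at level `p₁ + 1` only the floor matters

For a deleted set `D` with floor `p₁ = min D` (`p₁` prime), the kept Gram matrix at level `p₁ + 1` equals the
single-deletion one: `S_{p₁+1}(ζ_{ℙ∖D}) = S_{p₁+1}(ζ_{ℙ∖{p₁}})` (a deleted `q ≥ p₁ + 1` is invisible there — at the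
node `log(p₁+1)` itself its hinge is `0`).  Hence the DETECTION LAW `M₀(ℙ∖D) = p₁ + 1` for `p₁ ∈ {2,3,5,7}` holds
for EVERY such `D`, in kernel form. -/

/-- Two deleted sets give the same hinge sum at `t` if, term by term, the membership tests agree or the hinge
vanishes. [folklore] -/
theorem deletedHinge_congr {D D' : Finset ℕ} {t : ℝ}
    (h : ∀ n, 1 ≤ n → n ≤ ⌊Real.exp |t|⌋₊ → ((n.minFac ∈ D ↔ n.minFac ∈ D') ∨ |t| = Real.log n)) :
    deletedHinge D t = deletedHinge D' t := by
  unfold deletedHinge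
  refine Finset.sum_congr rfl fun n hn ↦ ?_
  rw [Finset.mem_Icc] at hn
  rcases h n hn.1 hn.2 with hiff | habs
  · by_cases hD : n.minFac ∈ D
    · rw [if_pos hD, if_pos (hiff.1 hD)]
    · rw [if_neg hD, if_neg (fun h' ↦ hD (hiff.2 h'))]
  · rw [habs, sub_self, mul_zero]; split_ifs <;> rfl

/-- Below the floor `p = min D`, `minFac n ∈ D ↔ minFac n = p` for `n ≤ p`. [folklore] -/
theorem minFac_mem_iff_of_floor {D : Finset ℕ} {p : ℕ} (hp : p ∈ D) (hD : ∀ q ∈ D, p ≤ q)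
    {n : ℕ} (hn1 : 1 ≤ n) (hn : n ≤ p) : n.minFac ∈ D ↔ n.minFac ∈ ({p} : Finset ℕ) := by
  rw [Finset.mem_singleton]
  constructor
  · intro hmem
    have hle : p ≤ n.minFac := hD _ hmem
    have hle' : n.minFac ≤ n := Nat.minFac_le (by omega)
    omega
  · intro heq; rw [heq]; exact hp

/-- `⌊e^{|log a − log b|}⌋ < p` for nodes `2 ≤ a, b ≤ p + 1`. [folklore] -/
theorem floor_exp_abs_log_sub_lt {p : ℕ} (hp : p.Prime) {a b : ℕ} (ha : 2 ≤ a) (hb : 2 ≤ b)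
    (hap : a ≤ p + 1) (hbp : b ≤ p + 1) : ⌊Real.exp |Real.log (a : ℝ) - Real.log b|⌋₊ < p := by
  wlog hle : b ≤ a generalizing a b
  · rw [abs_sub_comm]; exact this hb ha hbp hap (by omega)
  have ha0 : (0 : ℝ) < a := by exact_mod_cast (by omega : 0 < a)
  have hb0 : (0 : ℝ) < b := by exact_mod_cast (by omega : 0 < b)
  have hlog : Real.log b ≤ Real.log a := Real.log_le_log hb0 (by exact_mod_cast hle)
  have hexp : Real.exp |Real.log (a : ℝ) - Real.log b| = a / b := by
    rw [abs_of_nonneg (by linarith), ← Real.log_div ha0.ne' hb0.ne', Real.exp_log (div_pos ha0 hb0)]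
  rw [hexp, Nat.floor_lt (div_pos ha0 hb0).le, div_lt_iff₀ hb0]
  have h1 : (a : ℝ) ≤ p + 1 := by exact_mod_cast hap
  have hb2 : (2 : ℝ) ≤ b := by exact_mod_cast hb
  have hp2 : (2 : ℝ) ≤ p := by exact_mod_cast hp.two_le
  nlinarith

/-- **ONLY THE FLOOR MATTERS at level `p₁ + 1`:** `keptScrewMatrix D p₁ = keptScrewMatrix {p₁} p₁` whenever
`p₁ = min D`. [folklore] -/
theorem keptScrewMatrix_of_floor_eq_singleton {D : Finset ℕ} {p : ℕ} (hpr : p.Prime) (hp : p ∈ D)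
    (hD : ∀ q ∈ D, p ≤ q) : keptScrewMatrix D p = keptScrewMatrix {p} p := by
  ext i j
  simp only [keptScrewMatrix, Matrix.of_apply, keptScrew]
  have hi := i.isLt
  have hj := j.isLt
  have node : ∀ m : ℕ, 1 ≤ m → m ≤ p + 1 →
      deletedHinge D (Real.log m) = deletedHinge {p} (Real.log m) := by
    intro m hm1 hm
    apply deletedHinge_congr
    intro n hn1 hn
    have hm0 : (0 : ℝ) < m := by exact_mod_cast hm1
    have habs : |Real.log (m : ℝ)| = Real.log m := abs_of_nonneg (Real.log_nonneg (by exact_mod_cast hm1))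
    have hfl : ⌊Real.exp |Real.log (m : ℝ)|⌋₊ = m := by rw [habs, Real.exp_log hm0, Nat.floor_natCast]
    rw [hfl] at hn
    by_cases hnp : n ≤ p
    · exact Or.inl (minFac_mem_iff_of_floor hp hD hn1 hnp)
    · right
      have hnm : n = m := by omega
      subst hnm
      exact habs
  have diff : ∀ a b : ℕ, 2 ≤ a → 2 ≤ b → a ≤ p + 1 → b ≤ p + 1 →
      deletedHinge D (Real.log a - Real.log b) = deletedHinge {p} (Real.log a - Real.log b) := by
    intro a b ha hb hap hbp
    apply deletedHinge_congr
    intro n hn1 hn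
    have hfl := floor_exp_abs_log_sub_lt hpr ha hb hap hbp
    exact Or.inl (minFac_mem_iff_of_floor hp hD hn1 (by omega))
  rw [node ((i : ℕ) + 2) (by omega) (by omega), node ((j : ℕ) + 2) (by omega) (by omega),
    diff ((i : ℕ) + 2) ((j : ℕ) + 2) (by omega) (by omega) (by omega) (by omega)]

/-- **DETECTION LAW at the floor (kernel, every `D`):** if `min D = p₁ ∈ {2, 3, 5, 7}` then the kept screw
matrix at level `M = p₁ + 1` is NOT positive semidefinite — while every level `M ≤ p₁` is positive definite
(§3).  `M₀(ℙ∖D) = p₁ + 1`, uniformly in the rest of `D`. [folklore] -/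
theorem keptScrewMatrix_floor_detection {D : Finset ℕ} {p : ℕ} (hfloor : p = 2 ∨ p = 3 ∨ p = 5 ∨ p = 7)
    (hp : p ∈ D) (hD : ∀ q ∈ D, p ≤ q) : ¬ (keptScrewMatrix D p).PosSemidef := by
  rcases hfloor with rfl | rfl | rfl | rfl
  · exact keptScrewMatrix_two_not_posSemidef hp
  · rw [keptScrewMatrix_of_floor_eq_singleton Nat.prime_three hp hD]
    exact keptScrewMatrix_three_not_posSemidef
  · rw [keptScrewMatrix_of_floor_eq_singleton Nat.prime_five hp hD]
    exact keptScrewMatrix_five_not_posSemidef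
  · rw [keptScrewMatrix_of_floor_eq_singleton (by norm_num : Nat.Prime 7) hp hD]
    exact keptScrewMatrix_seven_not_posSemidef

/-- … and the matching BLINDNESS below the floor, for the record: every level `M ≤ p₁` of such a `D` is
positive definite (`p₁ ≤ 127`). [folklore] -/
theorem keptScrewMatrix_floor_blind {D : Finset ℕ} {p n : ℕ} (hD : ∀ q ∈ D, p ≤ q) (hp : p ≤ 128)
    (hn : n + 1 ≤ p) : (keptScrewMatrix D n).PosDef :=
  keptScrewMatrix_posDef (by omega) fun q hq ↦ hn.trans (hD q hq)

end RhIdea6.G14.Transfer
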